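import Literature.Analysis.FunctionSpaces.BallLipschitzDomain
import Mathlib.Analysis.Convex.Continuous
import HarnessLib

/-!
# Bounded convex open sets are Lipschitz domains

Analysis/FunctionSpaces support file. The tree's Sobolev theory on domains — the Calderón–Stein
extension theorem (`stein_extension_holds`), the Sobolev inequality `W^{1,p}(Ω) ⊂ L^{p*}(Ω)`
(`exists_eLpNorm_le_of_memSobolevDomain_one`), the trace inequality and the density of
`C^∞(Ω̄)` (`SobolevTrace*`) — is stated for bounded **Lipschitz domains** in the sense of the
accepted `Literature.Analysis.FunctionSpaces.IsLipschitzDomain` (`SobolevTrace`; Grisvard,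
*Elliptic problems in nonsmooth domains* (1985), Def. 1.2.1.1: near every boundary point the open
set is, inside a ball, the strict epigraph of a Lipschitz function in some orthonormal
direction). So far this was known in the tree for balls (`isLipschitzDomain_ball`) and for `C^k`
domains (`IsContDiffDomain.isLipschitzDomain_holds`). This file proves the classical fact that
**every bounded convex open set is a Lipschitz domain** (`isLipschitzDomain_of_convex`;
Agranovich, *Sobolev Spaces, Their Generalizations and Elliptic Problems in Smooth and Lipschitz
Domains* (2015), §9.1, Cor. 9.1.2: "Any bounded convex domain is Lipschitz", p. 141 of the held
text, deduced there from Thm. 9.1.1 "Any convex function is locally Lipschitz continuous"), which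
makes that theory available on boxes, finite cylinders, polytopes, … — in particular on the period cell
`{r < 1} × (0, L)` of the periodic cylinder of the Euler files (`FluidPDE/Ferrari1993*`,
`FluidPDE/KatoLai*`), the use for which it is written.

## Proof

Let `Ω` be open, convex and bounded, `B(c, ρ) ⊆ Ω ⊆ B(c, R)`, and `x₀ ∈ ∂Ω`; then `x₀ ∉ Ω`, so
`δ = ‖c - x₀‖ ≥ ρ > 0`. Put `u = δ⁻¹ (c - x₀)` (the unit vector pointing from `x₀` to the centre),
`P y = y - ⟪y, u⟫ u`, `w₀ = P x₀ = P c`, `s_c = ⟪c, u⟫`, and along each line `w + ℝ u` let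
`S(w) = {s | w + s u ∈ Ω}` and `φ(w) = inf S(w)` (the lower boundary of `Ω` seen from the
direction `u`). For `‖w - w₀‖ < ρ` the point `w + s_c u = c + (w - w₀)` lies in `B(c, ρ) ⊆ Ω`, so
`S(w) ≠ ∅` and `φ(w) ≤ s_c`; and `Ω ⊆ B(c, R)` gives `s > s_c - ‖w‖ - R` on `S(w)`, so `φ` is
bounded on `B(w₀, ρ)`. Convexity of `Ω` makes `φ` a **convex function** on `B(w₀, ρ)`
(`a (w₁ + s₁ u) + b (w₂ + s₂ u) = (a w₁ + b w₂) + (a s₁ + b s₂) u`), hence Lipschitz on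
`B(w₀, ρ/2)` (Mathlib's `ConvexOn.lipschitzOnWith_of_abs_le`), and McShane's extension
(`LipschitzOnWith.extend_real`) provides a globally Lipschitz `γ` agreeing with `φ` there. Finally,
for `r = min (ρ/2) δ` and `y ∈ B(x₀, r)`, writing `y = w + s u` (`w = P y`, `s = ⟪y, u⟫`, so
`‖w - w₀‖ ≤ ‖y - x₀‖ < ρ/2` and `s < ⟪x₀, u⟫ + δ = s_c`): if `y ∈ Ω` then, `Ω` being open,
`s - ε ∈ S(w)` for small `ε > 0`, whence `φ(w) < s`; conversely if `φ(w) < s` there is `s' ∈ S(w)`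
with `s' < s < s_c`, and `y` lies on the segment from `w + s' u ∈ Ω` to `w + s_c u ∈ Ω`, so
`y ∈ Ω`. Thus `Ω ∩ B(x₀, r) = {y ∈ B(x₀, r) | γ(P y) < ⟪y, u⟫}`. (This is the argument
indicated by Agranovich, p. 141: near each boundary point a convex domain lies on one side of the
graph of a convex, hence locally Lipschitz (Thm. 9.1.1), function.) No finite-dimensionality is
needed.

## Mathlib / tree search

Mathlib (this pin): `ConvexOn.lipschitzOnWith_of_abs_le`, `ConvexOn.exists_lipschitzOnWith_of_isBounded`
(convex functions bounded on a ball are Lipschitz on smaller balls), `LipschitzOnWith.extend_real`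
(McShane), `Convex.segment_subset`; no notion of Lipschitz domain. Tree:
`isLipschitzDomain_ball` (`BallLipschitzDomain`), whose projection lemmas `projAlong_sub`,
`projAlong_add_smul`, `norm_projAlong_le`, `abs_inner_unit_le` (`LipschitzDomainCover`) are reused;
`lean search 'isLipschitzDomain_|IsLipschitzDomain'` shows no convex-set criterion.

## References

* M. S. Agranovich, *Sobolev Spaces, Their Generalizations and Elliptic Problems in Smooth and
  Lipschitz Domains*, Springer Monographs in Mathematics (2015), §9.1, Thm. 9.1.1 and
  Cor. 9.1.2 (p. 141 of the held text). [Agranovich2015]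
* P. Grisvard, *Elliptic problems in nonsmooth domains* (Pitman, 1985), Def. 1.2.1.1 (the
  definition rendered by `IsLipschitzDomain`). [Grisvard1985]
-/

noncomputable section

open Set Metric Topology TopologicalSpace
open scoped NNReal InnerProductSpace RealInnerProductSpace

namespace Literature.Analysis.FunctionSpaces

variable {E' : Type*} [NormedAddCommGroup E'] [InnerProductSpace ℝ E']

/-! ### The lower boundary function of a convex set along a direction -/

/-- Convexity of `Ω` makes the fibres `S(w) = {s | w + s • u ∈ Ω}` combine: `s₁ ∈ S(w₁)`,
`s₂ ∈ S(w₂)` give `a s₁ + b s₂ ∈ S(a w₁ + b w₂)`. [folklore] -/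
theorem convexComb_add_smul_mem {Ω : Set E'} (hΩ : Convex ℝ Ω) (u : E') {w₁ w₂ : E'}
    {s₁ s₂ a b : ℝ} (h₁ : w₁ + s₁ • u ∈ Ω) (h₂ : w₂ + s₂ • u ∈ Ω) (ha : 0 ≤ a) (hb : 0 ≤ b)
    (hab : a + b = 1) : (a • w₁ + b • w₂) + (a * s₁ + b * s₂) • u ∈ Ω := by
  have := hΩ h₁ h₂ ha hb hab
  convert this using 1
  simp only [smul_add, smul_smul, add_smul]
  abel

/-- **The lower boundary function of a convex set is convex**: for a convex `Ω` and a direction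
`u`, the function `φ(w) = inf {s | w + s • u ∈ Ω}` is convex on every convex set over which the
fibres `{s | w + s • u ∈ Ω}` are nonempty, provided they are bounded below. [folklore] -/
theorem convexOn_sInf_fibre {Ω : Set E'} (hΩ : Convex ℝ Ω) (u : E') {U : Set E'}
    (hU : Convex ℝ U) (hne : ∀ w ∈ U, {s : ℝ | w + s • u ∈ Ω}.Nonempty)
    (hbdd : ∀ w, BddBelow {s : ℝ | w + s • u ∈ Ω}) :
    ConvexOn ℝ U (fun w => sInf {s : ℝ | w + s • u ∈ Ω}) := by
  refine ⟨hU, fun w₁ hw₁ w₂ hw₂ a b ha hb hab => ?_⟩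
  simp only [smul_eq_mul]
  set φ : E' → ℝ := fun w => sInf {s : ℝ | w + s • u ∈ Ω} with hφ
  change φ (a • w₁ + b • w₂) ≤ a * φ w₁ + b * φ w₂
  refine le_of_forall_pos_lt_add fun ε hε => ?_
  obtain ⟨s₁, hs₁, hs₁lt⟩ := exists_lt_of_csInf_lt (hne w₁ hw₁)
    (lt_add_of_pos_right (φ w₁) (half_pos hε))
  obtain ⟨s₂, hs₂, hs₂lt⟩ := exists_lt_of_csInf_lt (hne w₂ hw₂)
    (lt_add_of_pos_right (φ w₂) (half_pos hε))
  have hmem := convexComb_add_smul_mem hΩ u hs₁ hs₂ ha hb hab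
  have hle : φ (a • w₁ + b • w₂) ≤ a * s₁ + b * s₂ := csInf_le (hbdd _) hmem
  have h₁ : a * s₁ ≤ a * (φ w₁ + ε / 2) := mul_le_mul_of_nonneg_left hs₁lt.le ha
  have h₂ : b * s₂ ≤ b * (φ w₂ + ε / 2) := mul_le_mul_of_nonneg_left hs₂lt.le hb
  have h₁₂ : a * s₁ + b * s₂ ≤ a * φ w₁ + b * φ w₂ + ε / 2 :=
    calc a * s₁ + b * s₂ ≤ a * (φ w₁ + ε / 2) + b * (φ w₂ + ε / 2) := add_le_add h₁ h₂
      _ = a * φ w₁ + b * φ w₂ + (a + b) * (ε / 2) := by ring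
      _ = a * φ w₁ + b * φ w₂ + ε / 2 := by rw [hab, one_mul]
  linarith [hle, h₁₂, half_lt_self hε]

/-! ### Convex bounded open sets -/

/-- **Bounded convex open sets are Lipschitz domains** (Agranovich, *Sobolev Spaces, Their
Generalizations and Elliptic Problems in Smooth and Lipschitz Domains* (2015), §9.1, Cor. 9.1.2:
"Any bounded convex domain is Lipschitz", from Thm. 9.1.1 "Any convex function is locally
Lipschitz continuous"): a bounded convex open subset `Ω` of a real inner product space is a
Lipschitz domain in the sense of the accepted
`IsLipschitzDomain` — near each boundary point `x₀`, inside `B(x₀, r)`, `Ω` is the strict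
epigraph `{γ(P y) < ⟪y, u⟫}` over the hyperplane `uᗮ`, `u` the unit vector from `x₀` towards the
centre of an interior ball, of (a McShane extension of) the lower boundary function
`φ(w) = inf {s | w + s u ∈ Ω}`, which is convex and bounded near `P x₀`, hence Lipschitz. The
empty set is covered (its frontier is empty); no finite-dimensionality or connectedness is
needed. [cite: Agranovich2015, §9.1 Cor. 9.1.2 with Thm. 9.1.1 (p. 141)] -/
theorem isLipschitzDomain_of_convex {Ω : Opens E'} (hconv : Convex ℝ (Ω : Set E'))
    (hbdd : Bornology.IsBounded (Ω : Set E')) : IsLipschitzDomain Ω := by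
  intro x₀ hx₀
  -- `Ω` is nonempty and `x₀ ∉ Ω`
  obtain ⟨c, hc⟩ : (Ω : Set E').Nonempty := by
    by_contra h
    rw [Set.not_nonempty_iff_eq_empty] at h
    rw [h, frontier_empty] at hx₀
    exact hx₀
  have hx₀Ω : x₀ ∉ (Ω : Set E') := fun h => by
    have hdis := Ω.isOpen.inter_frontier_eq
    exact (Set.eq_empty_iff_forall_notMem.1 hdis x₀) ⟨h, hx₀⟩
  -- an interior ball around `c` and an enclosing ball
  obtain ⟨ρ, hρ, hball⟩ := Metric.isOpen_iff.1 Ω.isOpen c hc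
  obtain ⟨R, hR⟩ := (Metric.isBounded_iff_subset_ball c).1 hbdd
  -- the direction `u` from `x₀` to `c`
  set δ : ℝ := ‖c - x₀‖ with hδ_def
  have hδρ : ρ ≤ δ := by
    by_contra h
    push Not at h
    refine hx₀Ω (hball ?_)
    rw [mem_ball, dist_eq_norm, ← norm_neg, neg_sub]
    exact h
  have hδ : 0 < δ := hρ.trans_le hδρ
  set u : E' := δ⁻¹ • (c - x₀) with hu_def
  have hcx : c - x₀ = δ • u := by
    rw [hu_def, smul_smul, mul_inv_cancel₀ hδ.ne', one_smul]
  have hu : ‖u‖ = 1 := by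
    rw [hu_def, norm_smul, norm_inv, Real.norm_eq_abs, abs_of_pos hδ, inv_mul_cancel₀ hδ.ne']
  have huu : ⟪u, u⟫ = (1 : ℝ) := by
    rw [real_inner_self_eq_norm_sq, hu, one_pow]
  set P : E' → E' := fun y => y - ⟪y, u⟫ • u with hP_def
  have hP : ∀ y, P y = y - ⟪y, u⟫ • u := fun y => rfl
  have hPdecomp : ∀ y, P y + ⟪y, u⟫ • u = y := fun y => sub_add_cancel _ _
  set w₀ : E' := P x₀ with hw₀
  set sc : ℝ := ⟪c, u⟫ with hsc
  have hcx' : c = x₀ + δ • u := by rw [← hcx]; abel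
  have hsc' : sc = ⟪x₀, u⟫ + δ := by
    rw [hsc, hcx', inner_add_left, real_inner_smul_left, huu, mul_one]
  have hPc : P c = w₀ := by
    rw [hw₀, hcx', projAlong_add_smul hu hP]
  have hc_dec : c = w₀ + sc • u := by
    rw [← hPc, hsc, hPdecomp]
  -- the fibres `S(w)` and the lower boundary function `φ`
  set S : E' → Set ℝ := fun w => {s : ℝ | w + s • u ∈ (Ω : Set E')} with hS
  set φ : E' → ℝ := fun w => sInf (S w) with hφ
  have hφS : ∀ w, φ w = sInf (S w) := fun w => rfl
  -- (1) nonempty fibres near `w₀`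
  have hS_mem : ∀ w, ‖w - w₀‖ < ρ → sc ∈ S w := by
    intro w hw
    change w + sc • u ∈ (Ω : Set E')
    refine hball ?_
    rw [mem_ball, dist_eq_norm, hc_dec, show w + sc • u - (w₀ + sc • u) = w - w₀ by abel]
    exact hw
  -- (2) fibres bounded below
  have hS_lb : ∀ w s, s ∈ S w → sc - ‖w‖ - R < s := by
    intro w s hs
    change w + s • u ∈ (Ω : Set E') at hs
    have h1 : ‖w + s • u - c‖ < R := by
      have := hR hs
      rwa [mem_ball, dist_eq_norm] at this
    have h2 : ⟪w + s • u - c, u⟫ = ⟪w, u⟫ + s - sc := by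
      rw [inner_sub_left, inner_add_left, real_inner_smul_left, huu, mul_one, hsc]
    have h3 : |⟪w + s • u - c, u⟫| ≤ ‖w + s • u - c‖ := abs_inner_unit_le hu _
    have h4 : ⟪w, u⟫ ≤ ‖w‖ := (real_inner_le_norm w u).trans (by rw [hu, mul_one])
    rw [abs_le] at h3
    linarith [h3.1]
  have hS_bdd : ∀ w, BddBelow (S w) := fun w =>
    ⟨sc - ‖w‖ - R, fun s hs => (hS_lb w s hs).le⟩
  have hφ_le : ∀ w, ‖w - w₀‖ < ρ → φ w ≤ sc := fun w hw =>
    csInf_le (hS_bdd w) (hS_mem w hw)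
  have hφ_ge : ∀ w, ‖w - w₀‖ < ρ → sc - ‖w‖ - R ≤ φ w := fun w hw =>
    le_csInf ⟨sc, hS_mem w hw⟩ fun s hs => (hS_lb w s hs).le
  -- (3) convexity on the ball `B(w₀, ρ)`
  have hφ_conv : ConvexOn ℝ (ball w₀ ρ) φ :=
    convexOn_sInf_fibre hconv u (convex_ball w₀ ρ)
      (fun w hw => ⟨sc, hS_mem w (by rwa [mem_ball, dist_eq_norm] at hw)⟩) hS_bdd
  -- (4) Lipschitz on `B(w₀, ρ/2)` and McShane extension
  set M : ℝ := |sc| + ‖w₀‖ + ρ + R with hM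
  have hφ_abs : ∀ a, dist a w₀ < ρ → |φ a| ≤ M := by
    intro a ha
    rw [dist_eq_norm] at ha
    have h1 := hφ_le a ha
    have h2 := hφ_ge a ha
    have h3 : ‖a‖ ≤ ‖a - w₀‖ + ‖w₀‖ := norm_le_norm_sub_add a w₀
    have h4 : 0 ≤ R := by
      have := hR hc
      rw [mem_ball, dist_self] at this
      exact this.le
    rw [abs_le]
    constructor
    · linarith [neg_abs_le sc]
    · linarith [le_abs_self sc]
  have hlip := hφ_conv.lipschitzOnWith_of_abs_le (half_pos hρ) hφ_abs
  obtain ⟨γ, hγ, hγeq⟩ := hlip.extend_real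
  refine ⟨min (ρ / 2) δ, by positivity, u, hu, γ, _, hγ, ?_⟩
  -- (5) the set identity inside `B(x₀, r)`, `r = min (ρ/2) δ`
  have key : ∀ y ∈ ball x₀ (min (ρ / 2) δ), y ∈ (Ω : Set E') ↔ γ (P y) < ⟪y, u⟫ := by
    intro y hy
    rw [mem_ball, dist_eq_norm, lt_min_iff] at hy
    set w : E' := P y with hw
    set s : ℝ := ⟪y, u⟫ with hs
    have hyws : y = w + s • u := (hPdecomp y).symm
    have hww₀ : ‖w - w₀‖ < ρ / 2 := by
      rw [hw, hw₀, projAlong_sub hP]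
      exact (norm_projAlong_le hu hP _).trans_lt hy.1
    have hww₀' : ‖w - w₀‖ < ρ := hww₀.trans (half_lt_self hρ)
    have hγφ : γ w = φ w := by
      refine (hγeq ?_).symm
      rw [mem_ball, dist_eq_norm]
      linarith
    rw [hγφ]
    constructor
    · -- `y ∈ Ω`: openness gives `s - ε ∈ S(w)`, so `φ w < s`
      intro hyΩ
      obtain ⟨ε, hε, hεball⟩ := Metric.isOpen_iff.1 Ω.isOpen y hyΩ
      have hmem : s - ε / 2 ∈ S w := by
        change w + (s - ε / 2) • u ∈ (Ω : Set E')
        refine hεball ?_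
        rw [mem_ball, dist_eq_norm, hyws,
          show w + (s - ε / 2) • u - (w + s • u) = -((ε / 2) • u) by rw [sub_smul]; abel,
          norm_neg, norm_smul, Real.norm_eq_abs, abs_of_pos (half_pos hε), hu, mul_one]
        exact half_lt_self hε
      have := csInf_le (hS_bdd w) hmem
      rw [← hφS] at this
      linarith
    · -- `φ w < s`: some `s' ∈ S(w)` with `s' < s < sc`; convexity along the segment
      intro hlt
      obtain ⟨s', hs'S, hs's⟩ := exists_lt_of_csInf_lt ⟨sc, hS_mem w hww₀'⟩ hlt
      have hssc : s < sc := by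
        have h1 : s = ⟪x₀, u⟫ + ⟪y - x₀, u⟫ := by
          rw [hs, ← inner_add_left, add_sub_cancel]
        have h2 : ⟪y - x₀, u⟫ < δ :=
          (le_abs_self _).trans_lt ((abs_inner_unit_le hu _).trans_lt hy.2)
        rw [h1, hsc']
        linarith
      have h₁ : w + s' • u ∈ (Ω : Set E') := hs'S
      have h₂ : w + sc • u ∈ (Ω : Set E') := hS_mem w hww₀'
      have hseg : y ∈ segment ℝ (w + s' • u) (w + sc • u) := by
        have hd : 0 < sc - s' := by linarith
        refine ⟨(sc - s) / (sc - s'), (s - s') / (sc - s'), by positivity,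
          div_nonneg (by linarith) hd.le, ?_, ?_⟩
        · rw [← add_div, show sc - s + (s - s') = sc - s' by ring, div_self hd.ne']
        · rw [hyws]
          have hcoef : (sc - s) / (sc - s') + (s - s') / (sc - s') = 1 := by
            rw [← add_div, show sc - s + (s - s') = sc - s' by ring, div_self hd.ne']
          have hcoef' : (sc - s) / (sc - s') * s' + (s - s') / (sc - s') * sc = s := by
            field_simp
            ring
          calc ((sc - s) / (sc - s')) • (w + s' • u) + ((s - s') / (sc - s')) • (w + sc • u)
              = ((sc - s) / (sc - s') + (s - s') / (sc - s')) • w +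
                  ((sc - s) / (sc - s') * s' + (s - s') / (sc - s') * sc) • u := by
                simp only [smul_add, smul_smul, add_smul]
                abel
            _ = w + s • u := by rw [hcoef, hcoef', one_smul]
      exact hconv.segment_subset h₁ h₂ hseg
  ext y
  simp only [mem_inter_iff, mem_setOf_eq]
  constructor
  · rintro ⟨h1, h2⟩
    exact ⟨h2, (key y h2).1 h1⟩
  · rintro ⟨h1, h2⟩
    exact ⟨(key y h1).2 h2, h1⟩

end Literature.Analysis.FunctionSpaces
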